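import Summits.QuantumFields.YangMills.Theorems.ToronSmallBallOwnAxisShiftBasic
import Summits.QuantumFields.YangMills.Theorems.QuantileBitPuritySU2ClassShiftEdge
import Summits.QuantumFields.YangMills.Theorems.QuantileBitPuritySectorTranslate
import Mathlib.MeasureTheory.Integral.Marginal
import HarnessLib

/-!
# The own-axis sheet shift: Jacobian bounds on one slice and on the ring of slices

Support module (`--supports` stmt-QuantumFields-24089, `ToronSmallBall.PeriodicOffCoreStripWindowDeep`; seat ym-dw-p1 g15).  The own-axis sheet
shift `ownShift θ` (defs module `ToronSmallBallOwnAxisShiftDefs`) is the composition, over the `L²` sites `x` of the plane `x₀ = 0`, of the one-link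
own-axis updates of the tree's Jacobian lemma `ClassShift.lintegral_indicator_update_classShift_le` (the updates commute: the rest `R_x` of a line
never contains a plane link).  Iterating that lemma:

* §1 `lintegral_pi_prod_mul_comp_le_pow` — a generic product lemma: if `∫ Φ · F∘T dμ ≤ c ∫ F dμ` for all measurable `F ≥ 0` on one factor, then on
  the finite product `∫ (∏ᵢ Φ(xᵢ)) · F(T∘x) dμ^ι ≤ c^{#ι} ∫ F dμ^ι` (Mathlib `lmarginal` induction);
* §2 partial shifts `siteTwist 0 (x ↦ if x ∈ S then ownAxisField θ U x else 1) U` over a set `S` of plane sites: `insert` = one more one-link update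
  (`partialShift_insert`), all of the plane = `ownShift θ` (`partialShift_plane`);
* §3 ★ `lintegral_shell_prod_mul_comp_ownShift_le` — ONE SLICE: on the event that every plane line holonomy lies in the chart shell
  `exp(ι{a ≤ ‖x‖ ≤ b})`, `∫ (∏_x 𝟙_shell(P_x U)) F(ownShift θ U) dU ≤ ρ^{L²} ∫ F dU` (`ρ` = the one-link Jacobian constant: `sin² r ≤ ρ sin²(r+θ)` on `[a,b]`);
* §4 ★ `lintegral_shell_prod_mul_comp_ownShift_slices_le` — THE RING: the same on `(seam field) × (n+1 slices)`, shifting every slice, constant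
  `ρ^{L²(n+1)}`, the seam field a spectator.

HONEST FRAMING: change-of-variables inequalities on finite products of compact groups; no estimate of any lattice cost; nothing about infinite volume,
the continuum limit or the Clay gap.  No `sorry`, no new axiom, no new definition.  References: [folklore]; [cite: Luscher1983, §2].
-/

set_option autoImplicit false

noncomputable section

open MeasureTheory Set Function
open scoped ENNReal BigOperators
open Literature.MathematicalPhysics.QuantumFieldTheory
open Literature.MathematicalPhysics.QuantumLattice
open Literature.MathematicalPhysics.QuantumFieldTheory.Balaban1983to89.T4HaarSU2ExpChart (expPoint)

namespace Summit.QuantumFields.YangMills.Theorems.FemtoTransferGap.OwnAxis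

open ClassShift
open Summit.QuantumFields.YangMills.Theorems.FemtoTransferGap.TT (gaugeMeasure isProbabilityMeasure_gaugeMeasure)

/-! ## §1 A generic product lemma -/

section Generic

variable {ι : Type*} [Fintype ι] [DecidableEq ι] {X : Type*} [MeasurableSpace X]

omit [Fintype ι] in
/-- The partial map `T_s`: apply `T` to the coordinates in `s`. [folklore] -/
theorem measurable_partialMap {T : X → X} (hT : Measurable T) (s : Finset ι) :
    Measurable fun x : ι → X => fun i => if i ∈ s then T (x i) else x i := by
  refine measurable_pi_lambda _ fun i => ?_
  by_cases hi : i ∈ s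
  · simp only [hi, if_true]; exact hT.comp (measurable_pi_apply i)
  · simp only [hi, if_false]; exact measurable_pi_apply i

/-- ★ **Product of one-factor Jacobian bounds.**  Let `μ` be σ-finite on `X`, `T : X → X` and `Φ : X → [0,∞]` measurable with
`∫ Φ · (F ∘ T) dμ ≤ c ∫ F dμ` for every measurable `F ≥ 0`.  Then on the product `μ^ι`:
`∫ (∏ᵢ Φ(xᵢ)) · F(i ↦ T(xᵢ)) dμ^ι ≤ c^{#ι} ∫ F dμ^ι` for every measurable `F ≥ 0`. [folklore] -/
theorem lintegral_pi_prod_mul_comp_le_pow (μ : Measure X) [SigmaFinite μ] {T : X → X} (hT : Measurable T) {Φ : X → ℝ≥0∞} (hΦ : Measurable Φ)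
    {c : ℝ≥0∞} (h1 : ∀ F : X → ℝ≥0∞, Measurable F → ∫⁻ x, Φ x * F (T x) ∂μ ≤ c * ∫⁻ x, F x ∂μ)
    (F : (ι → X) → ℝ≥0∞) (hF : Measurable F) :
    ∫⁻ x, (∏ i, Φ (x i)) * F (fun i => T (x i)) ∂(Measure.pi fun _ : ι => μ) ≤
      c ^ Fintype.card ι * ∫⁻ x, F x ∂(Measure.pi fun _ : ι => μ) := by
  -- partial maps and partial integrands
  set Ts : Finset ι → (ι → X) → (ι → X) := fun s x i => if i ∈ s then T (x i) else x i with hTs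
  set G : Finset ι → (ι → X) → ℝ≥0∞ := fun s x => (∏ i ∈ s, Φ (x i)) * F (Ts s x) with hG
  have hTsm : ∀ s, Measurable (Ts s) := fun s => measurable_partialMap hT s
  have hGm : ∀ s, Measurable (G s) := fun s =>
    (Finset.measurable_prod s fun i _ => hΦ.comp (measurable_pi_apply i)).mul (hF.comp (hTsm s))
  -- the claim for every finset of coordinates, by induction
  have key : ∀ s : Finset ι, ∀ x : ι → X,
      (∫⋯∫⁻_s, G s ∂fun _ : ι => μ) x ≤ c ^ s.card * (∫⋯∫⁻_s, F ∂fun _ : ι => μ) x := by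
    intro s
    induction s using Finset.induction_on with
    | empty =>
      intro x
      simp only [lmarginal_empty, Finset.card_empty, pow_zero, one_mul, hG, Finset.prod_empty]
      have : Ts ∅ x = x := funext fun i => by simp [hTs]
      rw [this]
    | insert i s hi ih =>
      intro x
      rw [lmarginal_insert _ (hGm _) hi, lmarginal_insert _ hF hi, Finset.card_insert_of_notMem hi, pow_succ]
      -- the inner marginal at `update x i y`
      have hinner : ∀ y : X, (∫⋯∫⁻_s, G (insert i s) ∂fun _ : ι => μ) (update x i y) =
          Φ y * (∫⋯∫⁻_s, G s ∂fun _ : ι => μ) (update x i (T y)) := by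
        intro y
        rw [lmarginal_update_of_notMem (hGm _) hi, lmarginal_update_of_notMem (hGm _) hi]
        -- pointwise identity of the integrands
        have hpt : (G (insert i s) ∘ fun z : ι → X => update z i y) = fun z => Φ y * (G s ∘ fun z : ι → X => update z i (T y)) z := by
          funext z
          simp only [comp_apply, hG]
          rw [Finset.prod_insert hi, update_self]
          have hprod : ∏ j ∈ s, Φ (update z i y j) = ∏ j ∈ s, Φ (update z i (T y) j) := by
            refine Finset.prod_congr rfl fun j hj => ?_
            have hji : j ≠ i := fun h => hi (h ▸ hj)
            rw [update_of_ne hji, update_of_ne hji]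
          have hT' : Ts (insert i s) (update z i y) = Ts s (update z i (T y)) := by
            funext j
            by_cases hji : j = i
            · subst hji; simp [hTs, hi]
            · by_cases hjs : j ∈ s
              · simp [hTs, hjs, hji, Finset.mem_insert]
              · simp [hTs, hjs, hji, Finset.mem_insert]
          rw [hprod, hT', mul_assoc]
        rw [hpt]
        -- constants come out of a marginal integral
        simp only [lmarginal]
        rw [lintegral_const_mul]
        exact ((hGm s).comp measurable_update_left).comp measurable_updateFinset
      simp_rw [hinner]
      -- apply the one-factor bound to `y ↦ (∫⋯∫⁻_s, F) (update x i y)` after the induction hypothesis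
      have hH : Measurable fun y : X => (∫⋯∫⁻_s, F ∂fun _ : ι => μ) (update x i y) := (hF.lmarginal _).comp (measurable_update x)
      have hm : Measurable fun y : X => Φ y * (∫⋯∫⁻_s, F ∂fun _ : ι => μ) (update x i (T y)) := hΦ.mul (hH.comp hT)
      calc ∫⁻ y, Φ y * (∫⋯∫⁻_s, G s ∂fun _ : ι => μ) (update x i (T y)) ∂μ
          ≤ ∫⁻ y, Φ y * (c ^ s.card * (∫⋯∫⁻_s, F ∂fun _ : ι => μ) (update x i (T y))) ∂μ :=
            lintegral_mono fun y => mul_le_mul' le_rfl (ih _)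
        _ = ∫⁻ y, c ^ s.card * (Φ y * (∫⋯∫⁻_s, F ∂fun _ : ι => μ) (update x i (T y))) ∂μ :=
            lintegral_congr fun y => by ring
        _ = c ^ s.card * ∫⁻ y, Φ y * (∫⋯∫⁻_s, F ∂fun _ : ι => μ) (update x i (T y)) ∂μ := lintegral_const_mul _ hm
        _ ≤ c ^ s.card * (c * ∫⁻ y, (∫⋯∫⁻_s, F ∂fun _ : ι => μ) (update x i y) ∂μ) :=
            mul_le_mul' le_rfl (h1 _ hH)
        _ = c ^ s.card * c * ∫⁻ y, (∫⋯∫⁻_s, F ∂fun _ : ι => μ) (update x i y) ∂μ := by rw [mul_assoc]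
  -- the case `s = univ`
  rcases isEmpty_or_nonempty (ι → X) with hX | ⟨⟨x₀⟩⟩
  · simp [lintegral_of_isEmpty]
  have h := key Finset.univ x₀
  rw [lmarginal_univ, lmarginal_univ, Finset.card_univ] at h
  have hG' : G Finset.univ = fun x => (∏ i, Φ (x i)) * F (fun i => T (x i)) := by
    funext x
    simp only [hG, hTs, Finset.mem_univ, if_true]
  rw [hG'] at h
  exact h

end Generic

/-! ## §2 Partial own-axis shifts over sets of plane sites -/

section Partial

variable {L : ℕ} [NeZero L]

omit [NeZero L] in
/-- The partial shift over the empty set is the identity. [folklore] -/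
theorem partialShift_empty (θ : ℝ) (U : GaugeConfig 3 L SU2) :
    siteTwist 0 (fun x => if x ∈ (∅ : Finset (Site 3 L)) then ownAxisField θ U x else 1) U = U := by
  funext e
  rw [siteTwist_apply]
  by_cases he : e.2 = 0 ∧ e.1 0 = 0
  · rw [if_pos he, if_neg (Finset.notMem_empty _), one_mul]
  · rw [if_neg he]

/-- ★ **One more plane site = one more one-link own-axis update**: for a plane site `y ∉ S`, the partial shift over `insert y S` is the partial
shift over `S` of the configuration updated at the link `(y,0)` by `classShift θ (U(y,0)·R_y) · R_y⁻¹` (the rests and the other holonomies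
do not see the update). [folklore] -/
theorem partialShift_insert (θ : ℝ) {S : Finset (Site 3 L)} {y : Site 3 L} (hy : y 0 = 0) (hyS : y ∉ S)
    (U : GaugeConfig 3 L SU2) :
    siteTwist 0 (fun x => if x ∈ insert y S then ownAxisField θ U x else 1) U =
      siteTwist 0 (fun x => if x ∈ S then
          ownAxisField θ (update U (y, 0) (classShift θ (U (y, 0) * lineHolonomy U 0 (L - 1) (y.shift 0)) * (lineHolonomy U 0 (L - 1) (y.shift 0))⁻¹)) x
        else 1)
        (update U (y, 0) (classShift θ (U (y, 0) * lineHolonomy U 0 (L - 1) (y.shift 0)) * (lineHolonomy U 0 (L - 1) (y.shift 0))⁻¹)) := by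
  set V := update U (y, 0) (classShift θ (U (y, 0) * lineHolonomy U 0 (L - 1) (y.shift 0)) * (lineHolonomy U 0 (L - 1) (y.shift 0))⁻¹) with hV
  funext e
  rw [siteTwist_apply, siteTwist_apply]
  by_cases he : e.2 = 0 ∧ e.1 0 = 0
  · rw [if_pos he, if_pos he]
    obtain ⟨x, k⟩ := e
    simp only at he
    obtain ⟨rfl, hx⟩ := he
    by_cases hxy : x = y
    · subst hxy
      rw [if_pos (Finset.mem_insert_self _ _), if_neg hyS, one_mul, hV, update_self, ownAxisField_apply, lineHolonomy_eq_mul_rest,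
        classShift_apply, mul_assoc, mul_assoc, mul_inv_cancel, mul_one]
    · have hne : ((x, (0 : Fin 3)) : Edge 3 L) ≠ (y, 0) := fun h => hxy (congrArg Prod.fst h)
      have hVx : V (x, 0) = U (x, 0) := by rw [hV, update_of_ne hne]
      by_cases hxS : x ∈ S
      · rw [if_pos (Finset.mem_insert_of_mem hxS), if_pos hxS, hVx, ownAxisField_apply, ownAxisField_apply, hV,
          lineHolonomy_update_of_ne U hx hy hxy]
      · have hxi : x ∉ insert y S := fun h => (Finset.mem_insert.1 h).elim hxy hxS
        rw [if_neg hxi, if_neg hxS, hVx]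
  · rw [if_neg he, if_neg he, hV, update_of_ne]
    rintro rfl
    exact he ⟨rfl, hy⟩

/-- The partial shift over ALL plane sites is the own-axis sheet shift. [folklore] -/
theorem partialShift_plane (θ : ℝ) (U : GaugeConfig 3 L SU2) :
    siteTwist 0 (fun x => if x ∈ (Finset.univ.filter fun x : Site 3 L => x 0 = 0) then ownAxisField θ U x else 1) U = ownShift θ U := by
  rw [ownShift_def]
  funext e
  rw [siteTwist_apply, siteTwist_apply]
  by_cases he : e.2 = 0 ∧ e.1 0 = 0
  · have hmem : e.1 ∈ Finset.univ.filter (fun x : Site 3 L => x 0 = 0) := Finset.mem_filter.2 ⟨Finset.mem_univ _, he.2⟩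
    rw [if_pos he, if_pos he, if_pos hmem]
  · rw [if_neg he, if_neg he]

omit [NeZero L] in
/-- A partial shift is measurable in the configuration. [folklore] -/
theorem measurable_partialShift (θ : ℝ) (S : Finset (Site 3 L)) :
    Measurable fun U : GaugeConfig 3 L SU2 => siteTwist 0 (fun x => if x ∈ S then ownAxisField θ U x else 1) U := by
  refine measurable_siteTwist_of_measurable (measurable_pi_lambda _ fun x => ?_)
  by_cases hx : x ∈ S
  · simp only [hx, if_true]; exact (measurable_pi_apply x).comp (measurable_ownAxisField θ)
  · simp only [hx, if_false]; exact measurable_const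

omit [NeZero L] in
/-- The one-link own-axis update is measurable. [folklore] -/
theorem measurable_update_classShift (θ : ℝ) {y : Site 3 L} :
    Measurable fun U : GaugeConfig 3 L SU2 =>
      update U (y, 0) (classShift θ (U (y, 0) * lineHolonomy U 0 (L - 1) (y.shift 0)) * (lineHolonomy U 0 (L - 1) (y.shift 0))⁻¹) := by
  have hP : Measurable fun U : GaugeConfig 3 L SU2 => U (y, 0) * lineHolonomy U 0 (L - 1) (y.shift 0) :=
    (measurable_pi_apply _).mul (measurable_lineHolonomy 0 _ _)
  have hf : Measurable fun U : GaugeConfig 3 L SU2 => classShift θ (U (y, 0) * lineHolonomy U 0 (L - 1) (y.shift 0)) * (lineHolonomy U 0 (L - 1) (y.shift 0))⁻¹ :=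
    ((measurable_classShift θ).comp hP).mul (measurable_lineHolonomy 0 _ _).inv
  exact measurable_update'.comp (measurable_id.prodMk hf)

end Partial

/-! ## §3 One slice -/

section Slice

variable {L : ℕ} [NeZero L]

omit [NeZero L] in
/-- The shell indicator of a line holonomy is measurable in the configuration. [folklore] -/
theorem measurable_shellIndicator_lineHolonomy {a b : ℝ} (hbπ : b < Real.pi) (x : Site 3 L) :
    Measurable fun U : GaugeConfig 3 L SU2 =>
      (expPoint '' {v : EuclideanSpace ℝ (Fin 3) | a ≤ ‖v‖ ∧ ‖v‖ ≤ b}).indicator (fun _ => (1 : ℝ≥0∞)) (lineHolonomy U 0 L x) := by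
  have hW : MeasurableSet (expPoint '' {v : EuclideanSpace ℝ (Fin 3) | a ≤ ‖v‖ ∧ ‖v‖ ≤ b}) :=
    Literature.MathematicalPhysics.QuantumFieldTheory.Balaban1983to89.T4HaarSU2ExpChart.measurableSet_image_expPoint
      (measurableSet_shell a b) (shell_subset_ball hbπ)
  exact (measurable_const.indicator hW).comp (measurable_lineHolonomy 0 L x)

/-- **Partial-shift Jacobian bound** (induction over the set of shifted plane lines): for `S ⊆ plane`,
`∫ (∏_{x ∈ S} 𝟙_shell(P_x U)) · F(partial shift over S) dU ≤ ρ^{#S} ∫ F dU`. [folklore] -/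
theorem lintegral_shell_prod_mul_comp_partialShift_le {θ a b ρ : ℝ} (ha : 0 < a) (hbπ : b < Real.pi) (haθ : 0 < a + θ) (hbθ : b + θ < Real.pi)
    (hρ : 0 ≤ ρ) (hsin : ∀ r : ℝ, a ≤ r → r ≤ b → Real.sin r ^ 2 ≤ ρ * Real.sin (r + θ) ^ 2)
    (S : Finset (Site 3 L)) (hS : ∀ x ∈ S, x 0 = 0) (F : GaugeConfig 3 L SU2 → ℝ≥0∞) (hF : Measurable F) :
    ∫⁻ U, (∏ x ∈ S, (expPoint '' {v : EuclideanSpace ℝ (Fin 3) | a ≤ ‖v‖ ∧ ‖v‖ ≤ b}).indicator (fun _ => (1 : ℝ≥0∞)) (lineHolonomy U 0 L x)) *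
        F (siteTwist 0 (fun x => if x ∈ S then ownAxisField θ U x else 1) U) ∂configMeasure SU2 L ≤
      ENNReal.ofReal ρ ^ S.card * ∫⁻ U, F U ∂configMeasure SU2 L := by
  classical
  set Sh : Set SU2 := expPoint '' {v : EuclideanSpace ℝ (Fin 3) | a ≤ ‖v‖ ∧ ‖v‖ ≤ b} with hSh
  induction S using Finset.induction_on generalizing F with
  | empty =>
    simp only [Finset.prod_empty, one_mul, Finset.card_empty, pow_zero, partialShift_empty]
    exact le_rfl
  | insert y S hyS ih =>
    have hy : y 0 = 0 := hS y (Finset.mem_insert_self _ _)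
    have hS' : ∀ x ∈ S, x 0 = 0 := fun x hx => hS x (Finset.mem_insert_of_mem hx)
    -- the one-link update at `(y,0)` and the integrand after it
    set R : GaugeConfig 3 L SU2 → SU2 := fun U => lineHolonomy U 0 (L - 1) (y.shift 0) with hR
    set E : GaugeConfig 3 L SU2 → GaugeConfig 3 L SU2 := fun U => update U (y, 0) (classShift θ (U (y, 0) * R U) * (R U)⁻¹) with hE
    set G : GaugeConfig 3 L SU2 → ℝ≥0∞ := fun V =>
      (∏ x ∈ S, Sh.indicator (fun _ => (1 : ℝ≥0∞)) (lineHolonomy V 0 L x)) * F (siteTwist 0 (fun x => if x ∈ S then ownAxisField θ V x else 1) V) with hG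
    have hGm : Measurable G :=
      (Finset.measurable_prod S fun x _ => measurable_shellIndicator_lineHolonomy hbπ x).mul (hF.comp (measurable_partialShift θ S))
    -- rewrite the integrand as `𝟙_shell(U(y,0)·R U) · G(E U)`
    have hpt : ∀ U : GaugeConfig 3 L SU2,
        (∏ x ∈ insert y S, Sh.indicator (fun _ => (1 : ℝ≥0∞)) (lineHolonomy U 0 L x)) *
            F (siteTwist 0 (fun x => if x ∈ insert y S then ownAxisField θ U x else 1) U) =
          Sh.indicator (fun _ => (1 : ℝ≥0∞)) (U (y, 0) * R U) * G (E U) := by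
      intro U
      rw [Finset.prod_insert hyS, lineHolonomy_eq_mul_rest U y, hG]
      simp only []
      rw [partialShift_insert θ hy hyS U]
      have hprod : ∏ x ∈ S, Sh.indicator (fun _ => (1 : ℝ≥0∞)) (lineHolonomy U 0 L x) =
          ∏ x ∈ S, Sh.indicator (fun _ => (1 : ℝ≥0∞)) (lineHolonomy (E U) 0 L x) := by
        refine Finset.prod_congr rfl fun x hx => ?_
        have hxy : x ≠ y := fun h => hyS (h ▸ hx)
        rw [hE]
        simp only []
        rw [lineHolonomy_update_of_ne U (hS' x hx) hy hxy]
      rw [hprod, mul_assoc]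
    simp_rw [hpt]
    -- the one-link Jacobian lemma, then the induction hypothesis
    have hEdge := lintegral_indicator_update_classShift_le (L := L) (y, 0) (R := R) (measurable_lineHolonomy 0 _ _)
      (fun U W => lineRest_update U hy W hy) ha hbπ haθ hbθ hρ hsin G hGm
    calc ∫⁻ U, Sh.indicator (fun _ => (1 : ℝ≥0∞)) (U (y, 0) * R U) * G (E U) ∂configMeasure SU2 L
        ≤ ENNReal.ofReal ρ * ∫⁻ U, G U ∂configMeasure SU2 L := hEdge
      _ ≤ ENNReal.ofReal ρ * (ENNReal.ofReal ρ ^ S.card * ∫⁻ U, F U ∂configMeasure SU2 L) := mul_le_mul' le_rfl (ih hS' F hF)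
      _ = ENNReal.ofReal ρ ^ (insert y S).card * ∫⁻ U, F U ∂configMeasure SU2 L := by
          rw [Finset.card_insert_of_notMem hyS, pow_succ, ← mul_assoc, mul_comm (ENNReal.ofReal ρ)]

/-- ★ **ONE SLICE**: on the event that every plane line holonomy lies in the chart shell `exp(ι{a ≤ ‖x‖ ≤ b})`,
`∫ (∏_{x₀ = 0} 𝟙_shell(P_x U)) · F(ownShift θ U) dU ≤ ρ^{#plane} ∫ F dU` for every measurable `F ≥ 0`. [cite: Luscher1983, §2] -/
theorem lintegral_shell_prod_mul_comp_ownShift_le {θ a b ρ : ℝ} (ha : 0 < a) (hbπ : b < Real.pi) (haθ : 0 < a + θ) (hbθ : b + θ < Real.pi)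
    (hρ : 0 ≤ ρ) (hsin : ∀ r : ℝ, a ≤ r → r ≤ b → Real.sin r ^ 2 ≤ ρ * Real.sin (r + θ) ^ 2)
    (F : GaugeConfig 3 L SU2 → ℝ≥0∞) (hF : Measurable F) :
    ∫⁻ U, (∏ x ∈ Finset.univ.filter (fun x : Site 3 L => x 0 = 0),
          (expPoint '' {v : EuclideanSpace ℝ (Fin 3) | a ≤ ‖v‖ ∧ ‖v‖ ≤ b}).indicator (fun _ => (1 : ℝ≥0∞)) (lineHolonomy U 0 L x)) *
        F (ownShift θ U) ∂configMeasure SU2 L ≤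
      ENNReal.ofReal ρ ^ (Finset.univ.filter (fun x : Site 3 L => x 0 = 0)).card * ∫⁻ U, F U ∂configMeasure SU2 L := by
  have h := lintegral_shell_prod_mul_comp_partialShift_le (L := L) ha hbπ haθ hbθ hρ hsin (Finset.univ.filter fun x : Site 3 L => x 0 = 0)
    (fun x hx => (Finset.mem_filter.1 hx).2) F hF
  simp_rw [partialShift_plane] at h
  exact h

end Slice

/-! ## §4 The ring of slices with the seam field as a spectator -/

section Ring

variable {L : ℕ} [NeZero L]

/-- ★ **THE RING**: on `(seam field) × (n+1 slices)`, shifting every slice by `ownShift θ`,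
`∫ (∏_t ∏_{x₀=0} 𝟙_shell(P_x(U_t))) · F(g, (ownShift θ U_t)_t) ≤ (ρ^{#plane})^{n+1} ∫ F` for every measurable `F ≥ 0`. [cite: Luscher1983, §2] -/
theorem lintegral_shell_prod_mul_comp_ownShift_slices_le {θ a b ρ : ℝ} (ha : 0 < a) (hbπ : b < Real.pi) (haθ : 0 < a + θ) (hbθ : b + θ < Real.pi)
    (hρ : 0 ≤ ρ) (hsin : ∀ r : ℝ, a ≤ r → r ≤ b → Real.sin r ^ 2 ≤ ρ * Real.sin (r + θ) ^ 2) (n : ℕ)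
    (F : (Site 3 L → SU2) × (Fin (n + 1) → GaugeConfig 3 L SU2) → ℝ≥0∞) (hF : Measurable F) :
    ∫⁻ p, (∏ t : Fin (n + 1), ∏ x ∈ Finset.univ.filter (fun x : Site 3 L => x 0 = 0),
          (expPoint '' {v : EuclideanSpace ℝ (Fin 3) | a ≤ ‖v‖ ∧ ‖v‖ ≤ b}).indicator (fun _ => (1 : ℝ≥0∞)) (lineHolonomy (p.2 t) 0 L x)) *
        F (p.1, fun t => ownShift θ (p.2 t)) ∂((gaugeMeasure L).prod (Measure.pi fun _ : Fin (n + 1) => configMeasure SU2 L)) ≤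
      (ENNReal.ofReal ρ ^ (Finset.univ.filter (fun x : Site 3 L => x 0 = 0)).card) ^ (n + 1) *
        ∫⁻ p, F p ∂((gaugeMeasure L).prod (Measure.pi fun _ : Fin (n + 1) => configMeasure SU2 L)) := by
  haveI := isProbabilityMeasure_gaugeMeasure (L := L)
  set Φ : GaugeConfig 3 L SU2 → ℝ≥0∞ := fun U => ∏ x ∈ Finset.univ.filter (fun x : Site 3 L => x 0 = 0),
    (expPoint '' {v : EuclideanSpace ℝ (Fin 3) | a ≤ ‖v‖ ∧ ‖v‖ ≤ b}).indicator (fun _ => (1 : ℝ≥0∞)) (lineHolonomy U 0 L x) with hΦ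
  have hΦm : Measurable Φ := Finset.measurable_prod _ fun x _ => measurable_shellIndicator_lineHolonomy hbπ x
  set c : ℝ≥0∞ := ENNReal.ofReal ρ ^ (Finset.univ.filter (fun x : Site 3 L => x 0 = 0)).card with hc
  -- the slice product for a fixed seam field
  have hslices : ∀ g : Site 3 L → SU2,
      ∫⁻ Us, (∏ t, Φ (Us t)) * F (g, fun t => ownShift θ (Us t)) ∂(Measure.pi fun _ : Fin (n + 1) => configMeasure SU2 L) ≤
        c ^ (n + 1) * ∫⁻ Us, F (g, Us) ∂(Measure.pi fun _ : Fin (n + 1) => configMeasure SU2 L) := by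
    intro g
    have h := lintegral_pi_prod_mul_comp_le_pow (ι := Fin (n + 1)) (configMeasure SU2 L) (measurable_ownShift θ) hΦm (c := c)
      (fun F' hF' => lintegral_shell_prod_mul_comp_ownShift_le ha hbπ haθ hbθ hρ hsin F' hF') (fun Us => F (g, Us)) (hF.comp measurable_prodMk_left)
    simpa only [Fintype.card_fin] using h
  -- Fubini in the seam field
  have hm1 : Measurable fun p : (Site 3 L → SU2) × (Fin (n + 1) → GaugeConfig 3 L SU2) => (∏ t, Φ (p.2 t)) * F (p.1, fun t => ownShift θ (p.2 t)) := by
    refine ((Finset.measurable_prod _ fun t _ => hΦm.comp ((measurable_pi_apply t).comp measurable_snd))).mul (hF.comp ?_)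
    exact measurable_fst.prodMk (measurable_pi_lambda _ fun t => (measurable_ownShift θ).comp ((measurable_pi_apply t).comp measurable_snd))
  rw [lintegral_prod _ hm1.aemeasurable, lintegral_prod _ hF.aemeasurable]
  calc ∫⁻ g, ∫⁻ Us, (∏ t, Φ (Us t)) * F (g, fun t => ownShift θ (Us t)) ∂(Measure.pi fun _ : Fin (n + 1) => configMeasure SU2 L) ∂gaugeMeasure L
      ≤ ∫⁻ g, c ^ (n + 1) * ∫⁻ Us, F (g, Us) ∂(Measure.pi fun _ : Fin (n + 1) => configMeasure SU2 L) ∂gaugeMeasure L :=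
        lintegral_mono fun g => hslices g
    _ = c ^ (n + 1) * ∫⁻ g, ∫⁻ Us, F (g, Us) ∂(Measure.pi fun _ : Fin (n + 1) => configMeasure SU2 L) ∂gaugeMeasure L := by
        rw [lintegral_const_mul _ (hF.lintegral_prod_right')]

end Ring

end Summit.QuantumFields.YangMills.Theorems.FemtoTransferGap.OwnAxis

end
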